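import Mathlib
import Summits.Ventures.PercRepro2.Defs
import Summits.Ventures.PercRepro2.Independence
import Summits.Ventures.PercRepro2.Harris
import Summits.Ventures.PercRepro2.Graph
import Summits.Ventures.PercRepro2.Exploration
import Summits.Ventures.PercRepro2.Events
import Summits.Ventures.PercRepro2.Induced
import Summits.Ventures.PercRepro2.R2PrimeThreeReduction
import Summits.Ventures.PercRepro2.YBridge
import Summits.Ventures.PercRepro2.HCov
import Summits.Ventures.PercRepro2.HubModel
import Summits.Ventures.PercRepro2.HubModel3
import Summits.Ventures.PercRepro2.HubLaw3
import Summits.Ventures.PercRepro2.HubPat3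
import Summits.Ventures.PercRepro2.HubHarris3
import Summits.Ventures.PercRepro2.HubBundle3
import Summits.Ventures.PercRepro2.HubEvents3
import Summits.Ventures.PercRepro2.HubBern3
import Summits.Ventures.PercRepro2.HubGc3
import Summits.Ventures.PercRepro2.HubKron3
import Summits.Ventures.PercRepro2.HubTab3
import Summits.Ventures.PercRepro2.HubTab3Data1
import Summits.Ventures.PercRepro2.HubTab3Data2
import Summits.Ventures.PercRepro2.HubTab3Data3
import Summits.Ventures.PercRepro2.HubTab3Data4
import Summits.Ventures.PercRepro2.HubTab3Data5
import Summits.Ventures.PercRepro2.HubTab3Data6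
import Summits.Ventures.PercRepro2.HubTab3Data7
import Summits.Ventures.PercRepro2.HubTab3Data8
import Summits.Ventures.PercRepro2.HubTab3Data9
import Summits.Ventures.PercRepro2.HubTab3Data10
import Summits.Ventures.PercRepro2.HubTab3Data12
import Summits.Ventures.PercRepro2.HubTab3Defs

/-!
# Kernel check of the a₃-hub table, part 10 of 18: type vectors 91–103
(blind cell PercRepro2, mine-2 g17)

For every type vector `n` of this part, the Kronecker hub number computed from the tables of the
twelve hub functions (`kronK'`, HubTab3.lean) equals the Kronecker number of the certified table
(`certK`, HubTab3Defs.lean) — one GMP computation per `n` (`decide +kernel`; `387` state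
triples in this part). With `kronK'_eq`, `kronK_eq` and `digits_unique_idxA` this is the table
identity `Wtot3 k (atoms t) = W_k(t)` digit by digit.
-/

namespace Summit.Ventures.PercRepro2.Hub3

set_option maxHeartbeats 0 in
set_option maxRecDepth 100000 in
/-- The a₃-hub table at the type vector `91` agrees with the Lean hub functions (kernel). -/
theorem check_91 : kronK' (decode4 91) = certK 91 := by decide +kernel

set_option maxHeartbeats 0 in
set_option maxRecDepth 100000 in
/-- The a₃-hub table at the type vector `92` agrees with the Lean hub functions (kernel). -/
theorem check_92 : kronK' (decode4 92) = certK 92 := by decide +kernel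

set_option maxHeartbeats 0 in
set_option maxRecDepth 100000 in
/-- The a₃-hub table at the type vector `93` agrees with the Lean hub functions (kernel). -/
theorem check_93 : kronK' (decode4 93) = certK 93 := by decide +kernel

set_option maxHeartbeats 0 in
set_option maxRecDepth 100000 in
/-- The a₃-hub table at the type vector `94` agrees with the Lean hub functions (kernel). -/
theorem check_94 : kronK' (decode4 94) = certK 94 := by decide +kernel

set_option maxHeartbeats 0 in
set_option maxRecDepth 100000 in
/-- The a₃-hub table at the type vector `95` agrees with the Lean hub functions (kernel). -/
theorem check_95 : kronK' (decode4 95) = certK 95 := by decide +kernel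

set_option maxHeartbeats 0 in
set_option maxRecDepth 100000 in
/-- The a₃-hub table at the type vector `96` agrees with the Lean hub functions (kernel). -/
theorem check_96 : kronK' (decode4 96) = certK 96 := by decide +kernel

set_option maxHeartbeats 0 in
set_option maxRecDepth 100000 in
/-- The a₃-hub table at the type vector `97` agrees with the Lean hub functions (kernel). -/
theorem check_97 : kronK' (decode4 97) = certK 97 := by decide +kernel

set_option maxHeartbeats 0 in
set_option maxRecDepth 100000 in
/-- The a₃-hub table at the type vector `98` agrees with the Lean hub functions (kernel). -/
theorem check_98 : kronK' (decode4 98) = certK 98 := by decide +kernel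

set_option maxHeartbeats 0 in
set_option maxRecDepth 100000 in
/-- The a₃-hub table at the type vector `99` agrees with the Lean hub functions (kernel). -/
theorem check_99 : kronK' (decode4 99) = certK 99 := by decide +kernel

set_option maxHeartbeats 0 in
set_option maxRecDepth 100000 in
/-- The a₃-hub table at the type vector `100` agrees with the Lean hub functions (kernel). -/
theorem check_100 : kronK' (decode4 100) = certK 100 := by decide +kernel

set_option maxHeartbeats 0 in
set_option maxRecDepth 100000 in
/-- The a₃-hub table at the type vector `101` agrees with the Lean hub functions (kernel). -/
theorem check_101 : kronK' (decode4 101) = certK 101 := by decide +kernel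

set_option maxHeartbeats 0 in
set_option maxRecDepth 100000 in
/-- The a₃-hub table at the type vector `102` agrees with the Lean hub functions (kernel). -/
theorem check_102 : kronK' (decode4 102) = certK 102 := by decide +kernel

set_option maxHeartbeats 0 in
set_option maxRecDepth 100000 in
/-- The a₃-hub table at the type vector `103` agrees with the Lean hub functions (kernel). -/
theorem check_103 : kronK' (decode4 103) = certK 103 := by decide +kernel

end Summit.Ventures.PercRepro2.Hub3
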